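import Literature.ModelTheory.ExponentialFields.DefinablyCompleteInverseFunction
import Mathlib.LinearAlgebra.Matrix.NonsingularInverse
import HarnessLib

/-!
# The inverse function theorem over a definably complete ordered field, II: invertible Jacobian

Topic `Literature/ModelTheory/ExponentialFields`.  Continuation of
`DefinablyCompleteInverseFunction.lean` (Fornasiero–Servi 2010, §1.2: elementary real analysis
over a definably complete ordered field `K`; van den Dries 1998, Ch. 7, §2).  That file treats
definable maps `F : Kⁿ → Kⁿ` whose Jacobian is close to the identity; here the classical local
inverse function theorem is deduced by the linear change of coordinates `G = P · F`, `P` an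
inverse of the Jacobian `J(a)`:

* **`IsDefinablyComplete.exists_injOn_and_forall_exists_eq_of_jacobian`** — let the definable
  map `F` be continuous on an open box around `a`, with partial derivatives `J x i j` there,
  the Jacobian `x ↦ J x` continuous at `a` (entrywise, sup-ball form) and `J a` invertible
  (a two-sided inverse `P` is given).  Then for some `r > 0` the map `F` is injective on the
  closed box of radius `r` around `a`, and for some `c > 0` every `y` with
  `Σᵢ |yᵢ - F a i| < c` is of the form `F x` with `|xᵢ - aᵢ| < r`;
* `IsDefinablyComplete.exists_injOn_and_forall_exists_eq_of_det_ne_zero` — the same with the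
  hypothesis `det J(a) ≠ 0` (the inverse is Mathlib's `Matrix.nonsing_inv`).

Everything is proved; no definitions, no named facts.  Conventions as in part I.

## References

* A. Fornasiero, T. Servi, *Definably complete Baire structures*, Fund. Math. 209 (2010),
  §1.2. [FornasieroServi2010]
* L. van den Dries, *Tame topology and o-minimal structures* (1998), Ch. 7, §2.
  [Dries1998]
-/

open Set Function FirstOrder FirstOrder.Language
open _root_.Filter _root_.Topology

namespace Literature.ModelTheory.ExponentialFields

universe u v

variable {K : Type*} [Field K] [LinearOrder K] [IsStrictOrderedRing K] [TopologicalSpace K]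
  [OrderTopology K] {L : FirstOrder.Language.{u, v}} [L.Structure K] {n : ℕ}

/-! ### Linear algebra without matrices -/

omit [LinearOrder K] [IsStrictOrderedRing K] [TopologicalSpace K] [OrderTopology K]
  [L.Structure K] in
/-- If `A P = 1` entrywise then `A (P v) = v`. [folklore] -/
theorem sum_mul_sum_mul_eq_of_mul_eq_one {A P : Fin n → Fin n → K}
    (hAP : ∀ i j, ∑ k, A i k * P k j = if i = j then 1 else 0) (v : Fin n → K) (i : Fin n) :
    ∑ k, A i k * ∑ j, P k j * v j = v i := by
  classical
  calc ∑ k, A i k * ∑ j, P k j * v j = ∑ k, ∑ j, A i k * (P k j * v j) := by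
        simp only [Finset.mul_sum]
    _ = ∑ j, ∑ k, A i k * (P k j * v j) := Finset.sum_comm
    _ = ∑ j, (∑ k, A i k * P k j) * v j := by
        refine Finset.sum_congr rfl fun j _ => ?_
        rw [Finset.sum_mul]
        exact Finset.sum_congr rfl fun k _ => by ring
    _ = ∑ j, (if i = j then 1 else 0) * v j := by simp only [hAP]
    _ = v i := by simp [ite_mul]

omit [TopologicalSpace K] [OrderTopology K] [L.Structure K] in
/-- `|Σⱼ Pᵢⱼ wⱼ| ≤ (Σⱼ |Pᵢⱼ|) · M` when `|wⱼ| ≤ M`. [folklore] -/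
theorem abs_sum_mul_le_sum_abs_mul {m : ℕ} (P : Fin m → K) (w : Fin m → K) {M : K}
    (hw : ∀ j, |w j| ≤ M) : |∑ j, P j * w j| ≤ (∑ j, |P j|) * M := by
  calc |∑ j, P j * w j| ≤ ∑ j, |P j * w j| := Finset.abs_sum_le_sum_abs _ _
    _ ≤ ∑ j, |P j| * M := Finset.sum_le_sum fun j _ => by
        rw [abs_mul]; exact mul_le_mul_of_nonneg_left (hw j) (abs_nonneg _)
    _ = (∑ j, |P j|) * M := by rw [Finset.sum_mul]

/-! ### The local inverse function theorem -/

set_option maxHeartbeats 400000 in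
/-- **The local inverse function theorem** over a definably complete ordered field (set-level
form): let the definable map `F : Kⁿ → Kⁿ` be continuous on the open box
`{x | ∀ j, |xⱼ - aⱼ| < ρ}` with partial derivatives `J x i j = ∂Fᵢ/∂xⱼ (x)` there, let the
Jacobian be continuous at `a` (for every `ε > 0` some sup-ball around `a` has
`|J x i j - J a i j| ≤ ε`), and let `P` be a two-sided inverse of the matrix `J a`.  Then there
are `r ∈ (0, ρ)` and `c > 0` such that `F` is injective on the closed box of radius `r` around
`a` and every `y` with `Σᵢ |yᵢ - F a i| < c` equals `F x` for some `x` with `|xⱼ - aⱼ| < r`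
for all `j`.  (Apply part I to `G = P · F`, whose Jacobian `P · J(x)` is within `1/(2n+2)` of
the identity near `a`.) [folklore] -/
theorem _root_.FirstOrder.Language.IsDefinablyComplete.exists_injOn_and_forall_exists_eq_of_jacobian
    (hDC : L.IsDefinablyComplete K)
    (hlt : (univ : Set K).Definable L {v : Fin 2 → K | v 0 < v 1})
    (hadd : (univ : Set K).Definable L {v : Fin 3 → K | v 2 = v 0 + v 1})
    (hmul : (univ : Set K).Definable L {v : Fin 3 → K | v 2 = v 0 * v 1})
    {F : (Fin n → K) → Fin n → K} (hF : ∀ i, (univ : Set K).DefinableFun L fun x => F x i)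
    {J : (Fin n → K) → Fin n → Fin n → K} {a : Fin n → K} {ρ : K} (hρ : 0 < ρ)
    (hcont : ∀ i, ContinuousOn (fun x => F x i) {x | ∀ j, |x j - a j| < ρ})
    (hder : ∀ x : Fin n → K, (∀ j, |x j - a j| < ρ) →
      ∀ i j, HasPartialDerivAt (fun z => F z i) j (J x i j) x)
    (hJc : ∀ i j, ∀ ε : K, 0 < ε → ∃ δ : K, 0 < δ ∧ ∀ x : Fin n → K, (∀ k, |x k - a k| < δ) →
      |J x i j - J a i j| ≤ ε)
    {P : Fin n → Fin n → K} (hPJ : ∀ i j, ∑ k, P i k * J a k j = if i = j then 1 else 0)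
    (hJP : ∀ i j, ∑ k, J a i k * P k j = if i = j then 1 else 0) :
    ∃ r : K, 0 < r ∧ r < ρ ∧ InjOn F {x | ∀ j, a j - r ≤ x j ∧ x j ≤ a j + r} ∧
      ∃ c : K, 0 < c ∧ ∀ y : Fin n → K, (∑ i, |y i - F a i| < c) →
        ∃ x : Fin n → K, (∀ j, |x j - a j| < r) ∧ F x = y := by
  classical
  rcases isEmpty_or_nonempty (Fin n) with hn | hn
  · -- `n = 0`: everything is trivial
    refine ⟨ρ / 2, half_pos hρ, half_lt_self hρ, fun x _ y _ _ => funext fun i => (hn.false i).elim,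
      1, one_pos, fun y _ => ⟨a, fun j => (hn.false j).elim, funext fun i => (hn.false i).elim⟩⟩
  -- constants
  have hn0 : (0 : K) < n := by
    have : 0 < n := Fin.pos_iff_nonempty.2 hn
    exact_mod_cast this
  set η : K := 1 / (2 * n + 2) with hη
  have hηpos : 0 < η := by rw [hη]; positivity
  have h2nη : 2 * (n : K) * η ≤ 1 := by
    rw [hη, mul_one_div, div_le_one (by positivity)]
    linarith
  set SP : K := ∑ i, ∑ k, |P i k| with hSP
  have hSP0 : 0 ≤ SP := Finset.sum_nonneg fun i _ => Finset.sum_nonneg fun k _ => abs_nonneg _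
  have hSP1 : 0 < SP + 1 := by linarith
  have hrow : ∀ i, ∑ k, |P i k| ≤ SP := fun i =>
    Finset.single_le_sum (f := fun i => ∑ k, |P i k|)
      (fun i _ => Finset.sum_nonneg fun k _ => abs_nonneg _) (Finset.mem_univ i)
  set ε : K := η / (SP + 1) with hε
  have hεpos : 0 < ε := div_pos hηpos hSP1
  -- a common radius for the continuity of all entries of `J` at `a`
  have hδ : ∀ p : Fin n × Fin n, ∃ δ : K, 0 < δ ∧ ∀ x : Fin n → K, (∀ k, |x k - a k| < δ) →
      |J x p.1 p.2 - J a p.1 p.2| ≤ ε := fun p => hJc p.1 p.2 ε hεpos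
  choose δ hδpos hδ using hδ
  have hne : (Finset.univ : Finset (Fin n × Fin n)).Nonempty := Finset.univ_nonempty
  set δ₀ : K := Finset.univ.inf' hne δ with hδ₀
  have hδ₀pos : 0 < δ₀ := (Finset.lt_inf'_iff _).2 fun p _ => hδpos p
  have hδ₀le : ∀ p, δ₀ ≤ δ p := fun p => Finset.inf'_le _ (Finset.mem_univ p)
  set r : K := min (ρ / 2) (δ₀ / 2) with hr
  have hrpos : 0 < r := lt_min (half_pos hρ) (half_pos hδ₀pos)
  have hrρ : r < ρ := (min_le_left _ _).trans_lt (half_lt_self hρ)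
  have hrδ : ∀ p, r < δ p := fun p =>
    ((min_le_right _ _).trans_lt (half_lt_self hδ₀pos)).trans_le (hδ₀le p)
  -- the closed `r`-box lies in the open `ρ`-box and in the `δ`-balls
  set B : Set (Fin n → K) := {x | ∀ j, a j - r ≤ x j ∧ x j ≤ a j + r} with hB
  have hBρ : ∀ x ∈ B, ∀ j, |x j - a j| < ρ := fun x hx j =>
    lt_of_le_of_lt (abs_le.2 ⟨by linarith [(hx j).1], by linarith [(hx j).2]⟩) hrρ
  have hBδ : ∀ x ∈ B, ∀ p, ∀ k, |x k - a k| < δ p := fun x hx p k =>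
    lt_of_le_of_lt (abs_le.2 ⟨by linarith [(hx k).1], by linarith [(hx k).2]⟩) (hrδ p)
  have haB : a ∈ B := fun j => ⟨by linarith, by linarith⟩
  -- the map `G = P · F`, its Jacobian `HG = P · J`
  set G : (Fin n → K) → Fin n → K := fun x i => ∑ k, P i k * F x k with hG
  set HG : (Fin n → K) → Fin n → Fin n → K := fun x i j => ∑ k, P i k * J x k j with hHG
  have hGdef : ∀ i, (univ : Set K).DefinableFun L fun x => G x i := by
    intro i
    refine definableFun_sum hadd Finset.univ fun k _ => ?_
    exact definableFun_apply₂_params hmul (definableFun_const_params _ (mem_univ (P i k))) (hF k)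
  have hGder : ∀ x ∈ B, ∀ i j, HasPartialDerivAt (fun z => G z i) j (HG x i j) x := by
    intro x hx i j
    rw [hasPartialDerivAt_iff]
    refine HasFieldDerivAt.sum (Finset.univ : Finset (Fin n))
      (f := fun k t => P i k * F (update x j t) k) (f' := fun k => P i k * J x k j) (x := x j)
      fun k _ => ?_
    have h := hder x (hBρ x hx) k j
    rw [hasPartialDerivAt_iff] at h
    exact h.const_mul (P i k)
  have hGJ : ∀ x ∈ B, ∀ i j, |HG x i j - if i = j then 1 else 0| ≤ η := by
    intro x hx i j
    have hdiff : HG x i j - (if i = j then 1 else 0) = ∑ k, P i k * (J x k j - J a k j) := by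
      rw [← hPJ i j, hHG]
      simp only [mul_sub, Finset.sum_sub_distrib]
    rw [hdiff]
    calc |∑ k, P i k * (J x k j - J a k j)| ≤ (∑ k, |P i k|) * ε :=
          abs_sum_mul_le_sum_abs_mul (P i) (fun k => J x k j - J a k j)
            fun k => hδ (k, j) x (hBδ x hx (k, j))
      _ ≤ SP * ε := mul_le_mul_of_nonneg_right (hrow i) hεpos.le
      _ ≤ (SP + 1) * ε := mul_le_mul_of_nonneg_right (by linarith) hεpos.le
      _ = η := by rw [hε, mul_div_cancel₀ _ hSP1.ne']
  have hGcont : ∀ i, ContinuousOn (fun x => G x i) B := by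
    intro i
    refine continuousOn_finsetSum _ fun k _ => ?_
    exact continuousOn_const.mul ((hcont k).mono fun x hx => hBρ x hx)
  -- part I for `G`
  have hBbox : ∀ x ∈ B, ∀ y ∈ B, ∀ w : Fin n → K,
      (∀ j, min (x j) (y j) ≤ w j ∧ w j ≤ max (x j) (y j)) → w ∈ B := by
    intro x hx y hy w hw j
    have h1 := (hw j).1
    have h2 := (hw j).2
    exact ⟨le_trans (le_min (hx j).1 (hy j).1) h1, le_trans h2 (max_le (hx j).2 (hy j).2)⟩
  have hGinj : InjOn G B :=
    hDC.injOn_of_jacobian_near_one hlt hadd hmul hGdef h2nη hBbox hGder hGJ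
  refine ⟨r, hrpos, hrρ, ?_, r / (4 * (SP + 1)), by positivity, ?_⟩
  · -- injectivity of `F`
    intro x hx y hy hxy
    refine hGinj hx hy ?_
    funext i
    simp only [hG, hxy]
  · -- surjectivity onto a small `ℓ¹`-ball
    intro y hy
    set z : Fin n → K := fun i => ∑ k, P i k * y k with hz
    have hz' : ∑ i, |z i - G a i| < r / 4 := by
      have hyk : ∀ k, |y k - F a k| ≤ ∑ k, |y k - F a k| := fun k =>
        Finset.single_le_sum (f := fun k => |y k - F a k|) (fun k _ => abs_nonneg _)
          (Finset.mem_univ k)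
      have h1 : ∀ i, |z i - G a i| ≤ (∑ k, |P i k|) * ∑ k, |y k - F a k| := by
        intro i
        have hzi : z i - G a i = ∑ k, P i k * (y k - F a k) := by
          simp only [hz, hG, mul_sub, Finset.sum_sub_distrib]
        rw [hzi]
        exact abs_sum_mul_le_sum_abs_mul (P i) (fun k => y k - F a k) hyk
      have h2 : ∑ i, |z i - G a i| ≤ SP * ∑ k, |y k - F a k| := by
        calc ∑ i, |z i - G a i| ≤ ∑ i, (∑ k, |P i k|) * ∑ k, |y k - F a k| :=
              Finset.sum_le_sum fun i _ => h1 i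
          _ = SP * ∑ k, |y k - F a k| := by rw [hSP, Finset.sum_mul]
      have h3 : SP * ∑ k, |y k - F a k| ≤ (SP + 1) * ∑ k, |y k - F a k| :=
        mul_le_mul_of_nonneg_right (by linarith) (Finset.sum_nonneg fun k _ => abs_nonneg _)
      have h4 : (SP + 1) * ∑ k, |y k - F a k| < r / 4 := by
        have := hy
        rw [lt_div_iff₀ (by positivity)] at this
        rw [lt_div_iff₀ (by norm_num : (0 : K) < 4)]
        linarith
      linarith
    obtain ⟨x, hxr, hGx⟩ := hDC.exists_eq_of_jacobian_near_one hlt hadd hmul hGdef h2nη hrpos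
      hGcont (fun x hx => hGder x hx) (fun x hx => hGJ x hx) hz'
    refine ⟨x, hxr, funext fun i => ?_⟩
    -- `F x = J a (G x) = J a z = y`
    have h1 : F x i = ∑ k, J a i k * G x k := by
      simp only [hG]
      exact (sum_mul_sum_mul_eq_of_mul_eq_one hJP (F x) i).symm
    have h2 : y i = ∑ k, J a i k * z k := by
      simp only [hz]
      exact (sum_mul_sum_mul_eq_of_mul_eq_one hJP y i).symm
    rw [h1, h2, hGx]

/-- **The local inverse function theorem, determinant form**: as
`exists_injOn_and_forall_exists_eq_of_jacobian`, with the invertibility of the Jacobian at `a`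
stated as `det (J a) ≠ 0` (`Matrix.of (J a)`); the two-sided inverse is Mathlib's
`Matrix.nonsing_inv`. [folklore] -/
theorem _root_.FirstOrder.Language.IsDefinablyComplete.exists_injOn_and_forall_exists_eq_of_det_ne_zero
    (hDC : L.IsDefinablyComplete K)
    (hlt : (univ : Set K).Definable L {v : Fin 2 → K | v 0 < v 1})
    (hadd : (univ : Set K).Definable L {v : Fin 3 → K | v 2 = v 0 + v 1})
    (hmul : (univ : Set K).Definable L {v : Fin 3 → K | v 2 = v 0 * v 1})
    {F : (Fin n → K) → Fin n → K} (hF : ∀ i, (univ : Set K).DefinableFun L fun x => F x i)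
    {J : (Fin n → K) → Fin n → Fin n → K} {a : Fin n → K} {ρ : K} (hρ : 0 < ρ)
    (hcont : ∀ i, ContinuousOn (fun x => F x i) {x | ∀ j, |x j - a j| < ρ})
    (hder : ∀ x : Fin n → K, (∀ j, |x j - a j| < ρ) →
      ∀ i j, HasPartialDerivAt (fun z => F z i) j (J x i j) x)
    (hJc : ∀ i j, ∀ ε : K, 0 < ε → ∃ δ : K, 0 < δ ∧ ∀ x : Fin n → K, (∀ k, |x k - a k| < δ) →
      |J x i j - J a i j| ≤ ε)
    (hdet : (Matrix.of (J a)).det ≠ 0) :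
    ∃ r : K, 0 < r ∧ r < ρ ∧ InjOn F {x | ∀ j, a j - r ≤ x j ∧ x j ≤ a j + r} ∧
      ∃ c : K, 0 < c ∧ ∀ y : Fin n → K, (∑ i, |y i - F a i| < c) →
        ∃ x : Fin n → K, (∀ j, |x j - a j| < r) ∧ F x = y := by
  classical
  set M : Matrix (Fin n) (Fin n) K := Matrix.of (J a) with hM
  have hunit : IsUnit M.det := isUnit_iff_ne_zero.2 hdet
  have h1 : M⁻¹ * M = 1 := Matrix.nonsing_inv_mul M hunit
  have h2 : M * M⁻¹ = 1 := Matrix.mul_nonsing_inv M hunit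
  refine hDC.exists_injOn_and_forall_exists_eq_of_jacobian hlt hadd hmul hF hρ hcont hder hJc
    (P := fun i j => M⁻¹ i j) (fun i j => ?_) (fun i j => ?_)
  · have h := congr_fun (congr_fun h1 i) j
    rw [Matrix.mul_apply, Matrix.one_apply] at h
    simpa [hM] using h
  · have h := congr_fun (congr_fun h2 i) j
    rw [Matrix.mul_apply, Matrix.one_apply] at h
    simpa [hM] using h

end Literature.ModelTheory.ExponentialFields
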